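import Summits.CriticalPhenomena.CardyFormulaZ2.Theorems.CardyComplexConeSLESixFamiliesGiveCardyDefs
import Literature.Probability.LatticeModels.MedialExplorationChains
import Literature.Probability.LatticeModels.MeshDomainBigComponents
import Literature.Probability.Percolation.BoxCrossingProofs
import Literature.Probability.Percolation.TriCrossingSandwich

/-!
# Stub `stub_lowerRun` of line `collar-touch-sandwich` (crux `SLESixFamiliesGiveCardy`,
stmt-CriticalPhenomena-9654) — Part 1: lattice and continuum geometry

Helper file for `theorem stub_lowerRun : LowerRun` (the lower run inclusion: if the medial
exploration interface of a collared Dobrushin domain `D ⊇ Ω` stays `η`-away from the touch set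
`G`, the configuration has a free open crossing of `Ω_δ` from `(ab)_δ` to `(cd)_δ`).  Contents:

* corner bookkeeping of lattice faces (`eq_or_eq_cornerNeighbor_of_isCorner`,
  `isInnerFace_of_forall_corner`), and the distance of the square-lattice discrete boundary
  `zdBoundary` to the topological frontier (`exists_mem_frontier_dist_le_of_mem_zdBoundary`:
  every site of `zdBoundary` has a frontier point within `2δ` of its mesh point);
* continuum geometry of `LowerCollarGeom`: points of `closure D` outside `closure Ω` lie in the
  closed collars, and the normalised splitting with CLOSED collars DISJOINT from `Ω`
  (`LowerCollarGeom.exists_closed_split`);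
* the eventual (in the mesh) statement that WIRED sites (`zdArcA`) with mesh point in `Ω` are
  `η/2`-close to the touch set `G` (`lowerRun_wired_near_touch`, registered helper), from the
  Hausdorff guard `tendsto_arcA`, the `2δ`-closeness above and compactness of `D.arc 0`.

References: S. Smirnov, C. R. Acad. Sci. Paris 333 (2001), §2 (discrete domains, arcs,
exploration path); G. Grimmett, *Percolation* (1999), §11.2 (primal/dual/medial lattices).
-/

noncomputable section

open Set Filter Topology Metric MeasureTheory
open scoped NNReal
open Literature.Probability Literature.Probability.RandomPlanarGeometry
  Literature.Probability.LatticeModels Literature.Probability.Percolation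

namespace Summit.CriticalPhenomena.CardyFormulaZ2.Cruxes.SLESixFamiliesGiveCardy.CollarTouchSandwich

/-! ### Corners of a lattice face -/

/-- Two corners of the same face have mesh points within `2δ` of each other (coordinatewise
within one lattice step). -/
theorem dist_meshPoint_le_of_isCorner_of_isCorner {δ : ℝ} (hδ : 0 ≤ δ) {v w f : Site 2}
    (hv : IsCorner v f) (hw : IsCorner w f) :
    dist (meshPoint δ v) (meshPoint δ w) ≤ 2 * δ := by
  have hc : ∀ j : Fin 2, |((v j : ℤ) : ℝ) - (w j : ℝ)| ≤ 1 := by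
    intro j
    rcases hv j with h | h <;> rcases hw j with h' | h' <;> rw [h, h'] <;> push_cast <;>
      ring_nf <;> norm_num
  rw [Complex.dist_eq]
  refine (Complex.norm_le_abs_re_add_abs_im _).trans ?_
  have hre : |(meshPoint δ v - meshPoint δ w).re| ≤ δ := by
    rw [Complex.sub_re, meshPoint_re, meshPoint_re, ← mul_sub, abs_mul, abs_of_nonneg hδ]
    exact mul_le_of_le_one_right hδ (hc 0)
  have him : |(meshPoint δ v - meshPoint δ w).im| ≤ δ := by
    rw [Complex.sub_im, meshPoint_im, meshPoint_im, ← mul_sub, abs_mul, abs_of_nonneg hδ]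
    exact mul_le_of_le_one_right hδ (hc 1)
  linarith

/-- Every corner of a face is reached from a given corner `x` by at most two corner-neighbour
moves: it is `x`, the horizontal or vertical corner neighbour of `x`, or the diagonally
opposite corner. -/
theorem eq_or_eq_cornerNeighbor_of_isCorner {x v f : Site 2} (hx : IsCorner x f)
    (hv : IsCorner v f) :
    v = x ∨ v = cornerNeighbor x f 0 ∨ v = cornerNeighbor x f 1 ∨
      v = cornerNeighbor (cornerNeighbor x f 0) f 1 := by
  have hx0 := hx 0
  have hx1 := hx 1
  have hv0 := hv 0
  have hv1 := hv 1
  have n00 : cornerNeighbor x f 0 0 = 2 * f 0 + 1 - x 0 := by simp [cornerNeighbor]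
  have n01 : cornerNeighbor x f 0 1 = x 1 := cornerNeighbor_apply_of_ne (by decide)
  have n11 : cornerNeighbor x f 1 1 = 2 * f 1 + 1 - x 1 := by simp [cornerNeighbor]
  have n10 : cornerNeighbor x f 1 0 = x 0 := cornerNeighbor_apply_of_ne (by decide)
  have d0 : cornerNeighbor (cornerNeighbor x f 0) f 1 0 = 2 * f 0 + 1 - x 0 := by
    rw [cornerNeighbor_apply_of_ne (by decide), n00]
  have d1 : cornerNeighbor (cornerNeighbor x f 0) f 1 1 = 2 * f 1 + 1 - x 1 := by
    simp [cornerNeighbor]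
  by_cases h0 : v 0 = x 0
  · by_cases h1 : v 1 = x 1
    · exact Or.inl (Site.ext_two h0 h1)
    · refine Or.inr (Or.inr (Or.inl (Site.ext_two (by rw [n10, h0]) ?_)))
      rw [n11]; omega
  · by_cases h1 : v 1 = x 1
    · refine Or.inr (Or.inl (Site.ext_two ?_ (by rw [n01, h1])))
      rw [n00]; omega
    · refine Or.inr (Or.inr (Or.inr (Site.ext_two ?_ ?_)))
      · rw [d0]; omega
      · rw [d1]; omega

/-- **A face all of whose corners have mesh points in the domain and all of whose closed sides
lie in the closure is an inner face as soon as ONE of its corners is a site of `Ω_δ`**: the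
discrete domain is a union of mesh components, so the other corners are reached along the
sides. -/
theorem isInnerFace_of_forall_corner {E : DiscreteDobrushin} {x f : Site 2}
    (hx : x ∈ meshDomain E.Ω E.δ) (hxf : IsCorner x f)
    (hin : ∀ v, IsCorner v f → meshPoint E.δ v ∈ E.Ω)
    (hseg : ∀ v w, IsCorner v f → IsCorner w f → (zdGraph 2).Adj v w →
      segment ℝ (meshPoint E.δ v) (meshPoint E.δ w) ⊆ closure E.Ω) :
    E.IsInnerFace f := by
  have step : ∀ v, v ∈ meshDomain E.Ω E.δ → IsCorner v f → ∀ i,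
      cornerNeighbor v f i ∈ meshDomain E.Ω E.δ := fun v hv hvf i =>
    mem_meshDomain_of_meshGraph_adj hv (hin _ (isCorner_cornerNeighbor hvf i))
      (meshGraph_adj_iff.2 ⟨adj_cornerNeighbor hvf i,
        hseg _ _ hvf (isCorner_cornerNeighbor hvf i) (adj_cornerNeighbor hvf i)⟩)
  have hmd : ∀ v, IsCorner v f → v ∈ meshDomain E.Ω E.δ := by
    intro v hvf
    rcases eq_or_eq_cornerNeighbor_of_isCorner hxf hvf with rfl | rfl | rfl | rfl
    · exact hx
    · exact step _ hx hxf 0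
    · exact step _ hx hxf 1
    · exact step _ (step _ hx hxf 0) (isCorner_cornerNeighbor hxf 0) 1
  intro v w hvf hwf hadj
  exact discreteDomainGraph_adj_iff.2
    ⟨meshGraph_adj_iff.2 ⟨hadj, hseg v w hvf hwf hadj⟩, hmd v hvf, hmd w hwf⟩

/-- A point of the closed side `[δv, δw]` of a face is within `2δ` of the mesh point of any corner
`x` of that face. -/
theorem dist_le_of_mem_segment_corners {δ : ℝ} (hδ : 0 ≤ δ) {x v w f : Site 2}
    (hx : IsCorner x f) (hv : IsCorner v f) (hw : IsCorner w f) {z : ℂ}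
    (hz : z ∈ segment ℝ (meshPoint δ v) (meshPoint δ w)) : dist (meshPoint δ x) z ≤ 2 * δ := by
  have hsub : segment ℝ (meshPoint δ v) (meshPoint δ w) ⊆ closedBall (meshPoint δ x) (2 * δ) :=
    (convex_closedBall _ _).segment_subset
      (by rw [mem_closedBall, dist_comm]; exact dist_meshPoint_le_of_isCorner_of_isCorner hδ hx hv)
      (by rw [mem_closedBall, dist_comm]; exact dist_meshPoint_le_of_isCorner_of_isCorner hδ hx hw)
  have := hsub hz
  rwa [mem_closedBall, dist_comm] at this

/-- **Sites of the square-lattice discrete boundary are `2δ`-close to the frontier.**  For an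
open domain and a nonnegative mesh, every site `x ∈ zdBoundary` (a vertex-boundary site of
`Ω_δ`, or an endpoint of a face-boundary edge) has a point of `∂Ω` within `2δ` of its mesh
point: in the second case the non-inner face at `x` has a corner outside `Ω` or a side leaving
`Ω̄` (`isInnerFace_of_forall_corner`), and the segment from `δx ∈ Ω` to such a point meets `∂Ω`.
(Smirnov 2001, §2: the discrete boundary approximates `∂Ω`.) -/
theorem exists_mem_frontier_dist_le_of_mem_zdBoundary {E : DiscreteDobrushin} (hΩ : IsOpen E.Ω)
    (hδ : 0 ≤ E.δ) {x : Site 2} (hx : x ∈ E.zdBoundary) :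
    ∃ p ∈ frontier E.Ω, dist (meshPoint E.δ x) p ≤ 2 * E.δ := by
  rcases hx with hx | ⟨y, hxy, -, f, hf, hxf, -⟩
  · -- vertex-boundary site
    obtain ⟨y, hxy, w, hw, hwf⟩ := exists_mem_frontier_of_mem_meshBoundary hΩ hx
    refine ⟨w, hwf, ?_⟩
    have h1 : dist (meshPoint E.δ x) w ≤ dist (meshPoint E.δ x) (meshPoint E.δ y) :=
      dist_le_dist_of_mem_segment (left_mem_segment ℝ _ _) hw
    rw [dist_meshPoint_of_adj hxy, abs_of_nonneg hδ] at h1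
    linarith
  · -- endpoint of a face-boundary edge: `f` is a non-inner face at `x`
    have hxD : x ∈ meshDomain E.Ω E.δ := (discreteDomainGraph_adj_iff.1 hxy).2.1
    have hxΩ : meshPoint E.δ x ∈ E.Ω := meshDomain_subset_meshVertices _ _ hxD
    -- a point of the closed face outside `Ω`, within `2δ` of `δx`
    obtain ⟨q, hqΩ, hq⟩ : ∃ q, q ∉ E.Ω ∧ dist (meshPoint E.δ x) q ≤ 2 * E.δ := by
      by_contra hcon
      simp only [not_exists, not_and, not_le] at hcon
      refine hf (isInnerFace_of_forall_corner hxD hxf (fun v hv => ?_) (fun v w hv hw _ z hz => ?_))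
      · by_contra hvΩ
        exact lt_irrefl _
          ((hcon _ hvΩ).trans_le (dist_meshPoint_le_of_isCorner_of_isCorner hδ hxf hv))
      · by_contra hzc
        exact lt_irrefl _ ((hcon z (fun hzΩ => hzc (subset_closure hzΩ))).trans_le
          (dist_le_of_mem_segment_corners hδ hxf hv hw hz))
    obtain ⟨w, hw, hwf⟩ := exists_mem_segment_frontier hΩ hxΩ
      (fun h => hqΩ (h (right_mem_segment ℝ _ _)))
    exact ⟨w, hwf, (dist_le_dist_of_mem_segment (left_mem_segment ℝ _ _) hw).trans hq⟩

/-! ### Continuum geometry of the collared domain -/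

/-- A point of `closure D` outside `closure Ω` lies in any closed set containing `D ∖ Ω`
: it is a limit of points of `D` outside `closure Ω`. -/
theorem mem_of_mem_closure_of_not_mem_closure {D Ω C : Set ℂ} (hC : IsClosed C)
    (hsub : D \ Ω ⊆ C) {z : ℂ} (hz : z ∈ closure D) (hzΩ : z ∉ closure Ω) : z ∈ C := by
  have h1 : z ∈ closure ((closure Ω)ᶜ ∩ D) :=
    isClosed_closure.isOpen_compl.inter_closure ⟨hzΩ, hz⟩
  have h2 : (closure Ω)ᶜ ∩ D ⊆ C := fun w hw => hsub ⟨hw.2, fun hwΩ => hw.1 (subset_closure hwΩ)⟩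
  exact closure_minimal h2 hC h1

/-- **Normalised splitting of the collars.**  Under `LowerCollarGeom R D G` the part of `D`
outside `Ω` splits into two CLOSED pieces `C₀`, `C₂` DISJOINT from `Ω`, at distance `≥ r` from
each other, `C₀` at distance `≥ r` from the arcs other than `(ab) = R.arc 0`, `C₂` at distance
`≥ r` from the arcs other than `(cd) = R.arc 2`, with `D ∩ B(D.pt 0, r) ⊆ C₂` and
`D ∩ B(D.pt 1, r) ⊆ C₀` (replace the pieces of `split` by the closures of their parts outside
`Ω` and shrink `r` below the distance from the marks to `closure Ω`). -/
theorem LowerCollarGeom.exists_closed_split {R : ConformalRectangle} {D : DobrushinDomain}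
    {G : Set ℂ} (h : LowerCollarGeom R D G) :
    ∃ (C₀ C₂ : Set ℂ) (r : ℝ), 0 < r ∧ IsClosed C₀ ∧ IsClosed C₂ ∧
      Disjoint C₀ R.carrier ∧ Disjoint C₂ R.carrier ∧ D.carrier \ R.carrier ⊆ C₀ ∪ C₂ ∧
      (∀ z ∈ C₀, ∀ w ∈ C₂, r ≤ dist z w) ∧
      (∀ z ∈ C₀, ∀ i : Fin 4, i ≠ 0 → r ≤ infDist z (R.arc i)) ∧
      (∀ z ∈ C₂, ∀ i : Fin 4, i ≠ 2 → r ≤ infDist z (R.arc i)) ∧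
      ball (D.pt 0) r ∩ D.carrier ⊆ C₂ ∧ ball (D.pt 1) r ∩ D.carrier ⊆ C₀ := by
  obtain ⟨C₀, C₂, r, hr, hsub, hdist, h0, h2, hb0, hb1⟩ := h.split
  -- balls at the marks missing `closure Ω`
  have hball : ∀ i : Fin 2, ∃ ρ > 0, ball (D.pt i) ρ ⊆ (closure R.carrier)ᶜ := fun i =>
    Metric.isOpen_iff.1 isClosed_closure.isOpen_compl _ (h.pt_not_mem_closure i)
  obtain ⟨ρ₀, hρ₀, hρ₀b⟩ := hball 0
  obtain ⟨ρ₁, hρ₁, hρ₁b⟩ := hball 1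
  set r' := min r (min ρ₀ ρ₁) with hr'
  have hr'r : r' ≤ r := min_le_left _ _
  have hr'0 : r' ≤ ρ₀ := (min_le_right _ _).trans (min_le_left _ _)
  have hr'1 : r' ≤ ρ₁ := (min_le_right _ _).trans (min_le_right _ _)
  -- closed-set bookkeeping
  have hcl : ∀ {S : Set ℂ} {P : ℂ → Prop}, IsClosed {z | P z} → (∀ z ∈ S, P z) →
      ∀ z ∈ closure S, P z := fun hP hS z hz => closure_minimal (fun w hw => hS w hw) hP hz
  refine ⟨closure (C₀ \ R.carrier), closure (C₂ \ R.carrier), r', by positivity, isClosed_closure,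
    isClosed_closure, (disjoint_sdiff_left).closure_left R.isOpen,
    (disjoint_sdiff_left).closure_left R.isOpen, ?_, ?_, ?_, ?_, ?_, ?_⟩
  · rintro z ⟨hzD, hzΩ⟩
    rcases hsub ⟨hzD, hzΩ⟩ with hz | hz
    · exact Or.inl (subset_closure ⟨hz, hzΩ⟩)
    · exact Or.inr (subset_closure ⟨hz, hzΩ⟩)
  · have step1 : ∀ w ∈ C₂ \ R.carrier, ∀ z ∈ closure (C₀ \ R.carrier), r' ≤ dist z w :=
      fun w hw => hcl (isClosed_le continuous_const (continuous_id.dist continuous_const))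
        (fun z hz => hr'r.trans (hdist z hz.1 w hw.1))
    intro z hz
    exact hcl (isClosed_le continuous_const (continuous_const.dist continuous_id))
      (fun w hw => step1 w hw z hz)
  · intro z hz i hi
    refine hcl (isClosed_le continuous_const (continuous_infDist_pt _)) (fun w hw => ?_) z hz
    obtain ⟨h1, h2', h3⟩ := h0 w hw.1
    fin_cases i
    · exact absurd rfl hi
    · exact hr'r.trans h1
    · exact hr'r.trans h2'
    · exact hr'r.trans h3
  · intro z hz i hi
    refine hcl (isClosed_le continuous_const (continuous_infDist_pt _)) (fun w hw => ?_) z hz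
    obtain ⟨h1, h2', h3⟩ := h2 w hw.1
    fin_cases i
    · exact hr'r.trans h1
    · exact hr'r.trans h2'
    · exact absurd rfl hi
    · exact hr'r.trans h3
  · rintro z ⟨hz, hzD⟩
    refine subset_closure ⟨hb0 ⟨ball_subset_ball hr'r hz, hzD⟩, fun hzΩ => ?_⟩
    exact hρ₀b (ball_subset_ball hr'0 hz) (subset_closure hzΩ)
  · rintro z ⟨hz, hzD⟩
    refine subset_closure ⟨hb1 ⟨ball_subset_ball hr'r hz, hzD⟩, fun hzΩ => ?_⟩
    exact hρ₁b (ball_subset_ball hr'1 hz) (subset_closure hzΩ)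

/-! ### Eventual statements along the mesh filter -/

/-- Positive mesh, eventually along `𝓝[>] 0`. -/
theorem eventually_mesh_pos : ∀ᶠ δ : ℝ in 𝓝[>] 0, 0 < δ := eventually_mem_nhdsWithin

/-- Small mesh, eventually along `𝓝[>] 0`. -/
theorem eventually_mesh_lt {c : ℝ} (hc : 0 < c) : ∀ᶠ δ : ℝ in 𝓝[>] 0, δ < c :=
  (eventually_lt_nhds hc).filter_mono nhdsWithin_le_nhds

/-- **The discrete marked points sit at the marks, eventually.**  For a discretisation family,
for all small meshes each marked point of `D` has an `A`–`B` edge midpoint within `ε` of it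
(Hausdorff guard `tendsto_zdABEdges`). -/
theorem eventually_zdABEdges_near_pt {D : DobrushinDomain} {Λ : ℝ → DiscreteDobrushin}
    (hΛ : ZdDiscretisationFamily D Λ) {ε : ℝ} (hε : 0 < ε) :
    ∀ᶠ δ : ℝ in 𝓝[>] 0, ∀ i : Fin 2, ∃ e ∈ (Λ δ).zdABEdges, dist (medialPoint δ e) (D.pt i) < ε := by
  have hev := hΛ.tendsto_zdABEdges (Iio_mem_nhds (ENNReal.ofReal_pos.2 hε))
  filter_upwards [hev] with δ hδ i
  have hmem : D.pt i ∈ ({D.pt 0, D.pt 1} : Set ℂ) := by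
    fin_cases i
    · exact Or.inl rfl
    · exact Or.inr rfl
  have h1 : infEDist (D.pt i) (medialPoint δ '' (Λ δ).zdABEdges) < ENNReal.ofReal ε :=
    (infEDist_le_hausdorffEDist_of_mem hmem).trans_lt (by rwa [hausdorffEDist_comm])
  obtain ⟨_, ⟨e, he, rfl⟩, hlt⟩ := infEDist_lt_iff.1 h1
  refine ⟨e, he, ?_⟩
  rw [dist_comm]
  exact edist_lt_ofReal.1 hlt

/-- **Wired sites inside `Ω` are close to the touch set, eventually** (registered helper of
`stub_lowerRun`).  Under `LowerCollarGeom R D G`, for a discretisation family `Λ` of `D` and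
`η > 0`, for all small meshes `δ` every site of the wired arc `zdArcA (Λ δ)` whose mesh point lies
in `Ω` is within `η / 2` of `G`: such a site is `2δ`-close to `∂D`
(`exists_mem_frontier_dist_le_of_mem_zdBoundary`), hence (`≤`-rule of `zdDiscreteArc`)
`2δ`-close to the arc datum `arcA`, hence (Hausdorff guard `tendsto_arcA`) `o(1)`-close to a
point of `D.arc 0` near `closure Ω`, and such points are near `D.arc 0 ∩ closure Ω ⊆ G`
(compactness of `D.arc 0`, `arc_zero_inter_closure_subset`). -/
theorem lowerRun_wired_near_touch :
    ∀ (R : ConformalRectangle) (D : DobrushinDomain) (G : Set ℂ), LowerCollarGeom R D G → ∀ (Λ : ℝ → DiscreteDobrushin), ZdDiscretisationFamily D Λ → ∀ η : ℝ, 0 < η → ∀ᶠ δ : ℝ in 𝓝[>] 0, ∀ x ∈ (Λ δ).zdArcA, meshPoint δ x ∈ R.carrier → infDist (meshPoint δ x) G ≤ η / 2 := by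
  intro R D G hgeom Λ hΛ η hη
  -- the far part of the wired arc is a compact set missing `closure Ω`
  set K : Set ℂ := D.arc 0 ∩ {g | η / 4 ≤ infDist g G} with hK
  have hKc : IsCompact K :=
    (D.isCompact_arc 0).inter_right (isClosed_le continuous_const (continuous_infDist_pt G))
  have hKd : Disjoint K (closure R.carrier) := by
    refine Set.disjoint_left.2 fun g hg hgΩ => ?_
    have hgG : g ∈ G := hgeom.arc_zero_inter_closure_subset ⟨hg.1, hgΩ⟩
    have : η / 4 ≤ infDist g G := hg.2
    rw [infDist_zero_of_mem hgG] at this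
    linarith
  obtain ⟨ρ₀, hρ₀, hfar⟩ :=
    exists_pos_forall_lt_infDist hKc isClosed_closure hKd (R.nonempty.mono subset_closure)
  set τ := min (ρ₀ / 2) (η / 8) with hτ
  have hτpos : 0 < τ := by positivity
  have hτρ : τ ≤ ρ₀ / 2 := min_le_left _ _
  have hτη : τ ≤ η / 8 := min_le_right _ _
  have e3 : ∀ᶠ δ : ℝ in 𝓝[>] 0, hausdorffEDist (Λ δ).arcA (D.arc 0) < ENNReal.ofReal τ :=
    hΛ.tendsto_arcA (Iio_mem_nhds (ENNReal.ofReal_pos.2 hτpos))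
  filter_upwards [eventually_mesh_pos, eventually_mesh_lt (by positivity : 0 < τ / 3), e3] with δ
    hδ hδτ hH x hxA hxΩ
  have hΩ := hΛ.Ω_eq δ
  have hδE := hΛ.δ_eq δ
  obtain ⟨hxB, hxle⟩ := ((Λ δ).mem_zdDiscreteArc_iff).1 hxA
  rw [hδE] at hxle
  obtain ⟨p, hp, hpx⟩ := exists_mem_frontier_dist_le_of_mem_zdBoundary (E := Λ δ)
    (by rw [hΩ]; exact D.isOpen) (by rw [hδE]; exact hδ.le) hxB
  rw [hδE] at hpx
  -- `2δ`-close to the arc datum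
  have hA : infDist (meshPoint δ x) (Λ δ).arcA ≤ 2 * δ := by
    by_cases hpA : p ∈ (Λ δ).arcA
    · exact (infDist_le_dist_of_mem hpA).trans hpx
    · exact hxle.trans ((infDist_le_dist_of_mem
        (show p ∈ frontier (Λ δ).Ω \ (Λ δ).arcA from ⟨hp, hpA⟩)).trans hpx)
  -- `o(1)`-close to the wired arc of `D`
  have hHD : hausdorffDist (Λ δ).arcA (D.arc 0) < τ := ENNReal.toReal_lt_of_lt_ofReal hH
  have h0 : infDist (meshPoint δ x) (D.arc 0) < 2 * δ + τ :=
    (infDist_le_infDist_add_hausdorffDist hH.ne_top).trans_lt (by linarith)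
  obtain ⟨g, hg, hgx⟩ := (infDist_lt_iff (⟨_, D.pt_mem_arc_self 0⟩ : (D.arc 0).Nonempty)).1 h0
  -- that point of the wired arc is near `closure Ω`, hence near `G`
  have hgΩ : infDist g (closure R.carrier) < ρ₀ :=
    (infDist_le_dist_of_mem (subset_closure hxΩ)).trans_lt (by rw [dist_comm]; linarith)
  have hgG : infDist g G < η / 4 := by
    by_contra hcon
    exact lt_asymm hgΩ (hfar g ⟨hg, not_lt.1 hcon⟩)
  have := infDist_le_infDist_add_dist (x := meshPoint δ x) (y := g) (s := G)
  linarith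

end Summit.CriticalPhenomena.CardyFormulaZ2.Cruxes.SLESixFamiliesGiveCardy.CollarTouchSandwich

end
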